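import Mathlib.ModelTheory.Encoding
import Mathlib.ModelTheory.Satisfiability
import Mathlib.Computability.Halting
import Mathlib.Logic.Encodable.Basic
import Literature.ModelTheory.ExponentialFields.Languages
import HarnessLib

-- provenance: harness21/H21/H21/Prelude/TranscendEllArithS/DecidableTheory.lean @ 7998fb0 (interim HEAD d8f2665); M5 mechanical rewrite
/-!
# Gödel numbering of sentences and decidable first-order theories

Trunk `TranscendEllArithS`, concept C9 (`decidable_theory`).

We give a *computable* Gödel numbering of first-order sentences and define what it means for a
first-order theory to be decidable, recursively enumerable, recursively axiomatized and
computably axiomatizable. These notions are consumed by the statements of Tarski's theorem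
(decidability of real closed fields) and of Macintyre–Wilkie (decidability of `ℝ_exp` assuming
Schanuel's conjecture).

## Gödel numbering

Mathlib (`Mathlib/ModelTheory/Encoding.lean`) encodes terms and bounded formulas as lists
(`Term.listEncode`, `BoundedFormula.listEncode`, with computable decoders `listDecode` and the
round-trip lemma `BoundedFormula.listDecode_encode_list`) and derives a computable
`Encodable (L.Term α)` instance from them, but stops short of the corresponding instance for
formulas (only `Countable (Σ n, L.BoundedFormula α n)` is provided; the file's TODO mentions
this). We supply, mirroring Mathlib's `Term` instance literally,

* `Encodable (Σ n, L.BoundedFormula α n)`, `Encodable (L.Formula α)`, `Encodable L.Sentence`,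

all via `Encodable.ofLeftInjection`, hence *computable*: no `Encodable.ofCountable` and no
classical choice is used (that would make every decidability statement below vacuous, since
`ComputablePred` is about the concrete coding). The symbol types of the languages
`Language.ring`, `Literature.ModelTheory.ExponentialFields.Language.orderedRing`, `Literature.ModelTheory.ExponentialFields.Language.expRing`, `Literature.ModelTheory.ExponentialFields.Language.orderedExpRing`
receive explicit finite codings, so that sentences of these languages are encodable by
`inferInstance` (checked by `example`s below). `Sentence.godelNumber φ := Encodable.encode φ`.

## Decidability

Following Enderton (Ch. 3) and Marker (§2), a theory `T` is *decidable* when the set of Gödel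
numbers of its **consequences** `{⌜φ⌝ | T ⊨ φ}` is computable (`Theory.IsDecidable`, via Mathlib's
`ComputablePred` and semantic consequence `Theory.ModelsBoundedFormula`, notation `⊨ᵇ`); it is
*recursively enumerable* (`Theory.IsRE`) when that set is r.e. (`REPred`). The membership-level
notions "`T` is a recursive / r.e. set of axioms" are `Theory.IsRecursive` / `Theory.IsREAxioms`,
and `Theory.IsComputablyAxiomatizable T` asks for a recursive `A` with the same consequences.
With these conventions `Literature.ModelTheory.ExponentialFields.Theory.RCF.IsDecidable` is Tarski's theorem (not the triviality that
RCF has a recursive axiom list), while for maximal theories `T = L.completeTheory M` the two levels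
agree (`isDecidable_iff_isRecursive_of_isMaximal`, proved from
`Theory.IsMaximal.mem_iff_models`).

All these notions are relative to the chosen coding of the symbols. The enumerability theorem
(`IsComputablyAxiomatizable.isRE`) and Janiczak's theorem
(`isDecidable_of_isComplete_of_isComputablyAxiomatizable`) need the language to be *recursively
presented* (`Language.IsRecursivelyPresented`: the code sets `Set.range encode` of the symbols are
computable and arities are computable from codes — Enderton's "reasonable language", Mathlib's
`Primcodable.prim` condition); this is proved for the four concrete languages
(`Literature.ModelTheory.ExponentialFields.Language.orderedExpRing.isRecursivelyPresented` etc.).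

## Mathlib search

Mathlib has `ComputablePred`, `REPred`, `ComputablePred.to_re`, `Encodable.ofLeftInjection`,
`Term.listEncode/listDecode`, `BoundedFormula.listEncode/listDecode/listDecode_encode_list`,
`Theory.ModelsBoundedFormula`, `Theory.IsComplete`, `Theory.IsMaximal`,
`Theory.IsMaximal.mem_iff_models`, `completeTheory.isMaximal`, `Primrec.list_getElem?₁`,
`Sigma.encodable` (so `Encodable (Σ _ : ℕ, Empty)` is inferred; `Literature.ModelTheory.ExponentialFields.instEncodableSigmaEmpty` is
therefore only a non-instance `abbrev`). It has no `Encodable` instance for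
formulas/sentences, no Gödel numbering and no notion of decidable theory.

## Design choices

* The generic instances and definitions are deliberate dot-notation extensions in Mathlib's
  namespaces `FirstOrder.Language` (`Language.IsRecursivelyPresented` and its API, the auxiliary
  lemmas `Language.mem_range_encode_iff_decode_map_encode`,
  `Language.computablePred_mem_range_encode`) and
  `FirstOrder.Language.BoundedFormula/Formula/Sentence/Theory` (so that one writes
  `T.IsDecidable`, `φ.godelNumber`, `L.IsRecursivelyPresented`); the concrete symbol codings live
  in `namespace Literature`.
* Everything outside proofs is computable; the file has no `noncomputable section`.
* `Formula` and `Sentence` are `abbrev`s in Mathlib, so the `Formula` instance at `α = Empty`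
  already serves sentences; `Sentence.instEncodable` is a non-instance `abbrev` recorded for
  discoverability only (no duplicate instance).

## References

* H. B. Enderton, *A Mathematical Introduction to Logic*, Ch. 3 (Undecidability), §3.4–3.5.
* D. Marker, *Model Theory: An Introduction*, §2 (decidable theories, Lemma 2.2.8).
* A. Janiczak, *A remark concerning decidability of complete theories*, JSL 15 (1950);
  W. Craig, *On axiomatizability within a system*, JSL 18 (1953).
* Mathlib, `Mathlib/ModelTheory/Encoding.lean` (TODO: encodability of formulas).
-/

open FirstOrder

namespace FirstOrder.Language

variable {L : Language} {α : Type*}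

/-! ### Encodability of formulas and sentences -/

/-- Bounded formulas (packaged with their number of bound variables) are computably encodable as
soon as the free variables and the function and relation symbols are: the coding is Mathlib's
list encoding `BoundedFormula.listEncode` with decoder `BoundedFormula.listDecode`
(`Mathlib/ModelTheory/Encoding.lean`), exactly as Mathlib's `Encodable (L.Term α)` instance.
Enderton, *A Mathematical Introduction to Logic*, §3.4 (Gödel numbering). [folklore] -/
instance BoundedFormula.instEncodableSigma [Encodable α] [Encodable (Σ i, L.Functions i)]
    [Encodable (Σ i, L.Relations i)] : Encodable (Σ n, L.BoundedFormula α n) :=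
  Encodable.ofLeftInjection (fun φ => φ.2.listEncode)
    (fun l => (BoundedFormula.listDecode l).head?) fun φ => by
      have h := BoundedFormula.listDecode_encode_list [φ]
      rw [List.flatMap_singleton] at h
      rw [h, List.head?_cons]

/-- Formulas are computably encodable, via the inclusion `φ ↦ ⟨0, φ⟩` into
`Σ n, L.BoundedFormula α n` (Enderton §3.4). [folklore] -/
instance Formula.instEncodable [Encodable α] [Encodable (Σ i, L.Functions i)]
    [Encodable (Σ i, L.Relations i)] : Encodable (L.Formula α) :=
  Encodable.ofLeftInjection (fun φ => (⟨0, φ⟩ : Σ n, L.BoundedFormula α n))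
    (fun ψ => match ψ with
      | ⟨0, φ⟩ => some φ
      | ⟨_ + 1, _⟩ => none)
    fun _ => rfl

/-- Sentences are computably encodable (Gödel numbering; Enderton §3.4). Since `L.Sentence` is
an `abbrev` for `L.Formula Empty`, the instance `Formula.instEncodable` already applies; this is
recorded under its own name as a non-instance `abbrev` only (no duplicate instance). [folklore] -/
abbrev Sentence.instEncodable [Encodable (Σ i, L.Functions i)]
    [Encodable (Σ i, L.Relations i)] : Encodable L.Sentence :=
  Formula.instEncodable

/-- The Gödel number `⌜φ⌝` of a sentence: its code under the computable encoding
`Sentence.instEncodable` (Enderton §3.4; Marker §2). [folklore] -/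
def Sentence.godelNumber [Encodable (Σ i, L.Functions i)] [Encodable (Σ i, L.Relations i)]
    (φ : L.Sentence) : ℕ :=
  Encodable.encode φ

/-- Gödel numbering is injective (Enderton §3.4). [folklore] -/
theorem Sentence.godelNumber_injective [Encodable (Σ i, L.Functions i)]
    [Encodable (Σ i, L.Relations i)] :
    Function.Injective (Sentence.godelNumber : L.Sentence → ℕ) :=
  Encodable.encode_injective

/-! ### Recursively presented languages -/

/-- `L` is *recursively presented* with respect to the given symbol codings (Enderton, *A
Mathematical Introduction to Logic*, §3.4, "reasonable language"; Marker, *Model Theory*, §2,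
"recursive language"): the sets of *codes* `Set.range encode` of function and relation symbols
are computable subsets of `ℕ`, and the arity of a symbol is computable from its code. An
`Encodable` structure on the symbols may be an arbitrary injection into `ℕ` (with `decode`
possibly `some _` on non-codes), so this is a genuine hypothesis, needed for the enumerability
theorem and Janiczak's theorem below (compare the `prim` field of Mathlib's `Primcodable`,
`Mathlib/Computability/Primrec/Basic.lean`: "no predicates can be smuggled in through a cunning
choice of the subset of `ℕ`"). It holds trivially for finite languages with explicit finite
codings such as the ones at the end of this file. [folklore] -/
structure IsRecursivelyPresented (L : Language) [Encodable (Σ i, L.Functions i)]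
    [Encodable (Σ i, L.Relations i)] : Prop where
  /-- The arity of a function symbol is computable from any number decoding to it. -/
  computable_arity_functions :
    Computable fun n : ℕ => (Encodable.decode (α := Σ i, L.Functions i) n).map Sigma.fst
  /-- The arity of a relation symbol is computable from any number decoding to it. -/
  computable_arity_relations :
    Computable fun n : ℕ => (Encodable.decode (α := Σ i, L.Relations i) n).map Sigma.fst
  /-- Re-encoding after decoding is computable on function symbols, so that the set of *codes*
  `Set.range encode` of function symbols is computable (Mathlib's `Primcodable.prim` condition;
  see `IsRecursivelyPresented.computablePred_mem_range_encode_functions`). -/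
  computable_encode_decode_functions :
    Computable fun n : ℕ => (Encodable.decode (α := Σ i, L.Functions i) n).map Encodable.encode
  /-- Re-encoding after decoding is computable on relation symbols, so that the set of *codes*
  `Set.range encode` of relation symbols is computable. -/
  computable_encode_decode_relations :
    Computable fun n : ℕ => (Encodable.decode (α := Σ i, L.Relations i) n).map Encodable.encode

/-- For any encodable type, `n` is a code iff decoding and re-encoding `n` returns `n`. [folklore] -/
theorem mem_range_encode_iff_decode_map_encode {β : Type*} [Encodable β] (n : ℕ) :
    n ∈ Set.range (Encodable.encode : β → ℕ) ↔
      (Encodable.decode (α := β) n).map Encodable.encode = some n := by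
  constructor
  · rintro ⟨b, rfl⟩
    simp [Encodable.encodek]
  · intro h
    cases hd : Encodable.decode (α := β) n with
    | none => simp [hd] at h
    | some b =>
      rw [hd, Option.map_some, Option.some.injEq] at h
      exact ⟨b, h⟩

/-- A predicate `n ∈ Set.range encode` is computable as soon as `n ↦ (decode n).map encode` is
(decide the equation `(decode n).map encode = some n`; Mathlib `Primrec.eq`,
`ComputablePred.computable_iff`). [folklore] -/
theorem computablePred_mem_range_encode {β : Type*} [Encodable β]
    (h : Computable fun n : ℕ => (Encodable.decode (α := β) n).map Encodable.encode) :
    ComputablePred fun n : ℕ => n ∈ Set.range (Encodable.encode : β → ℕ) := by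
  refine ComputablePred.computable_iff.2
    ⟨fun n => decide ((Encodable.decode (α := β) n).map Encodable.encode = some n),
      Computable₂.comp (Primrec.eq (α := Option ℕ)).decide.to_comp h
        (Computable.option_some.comp Computable.id), ?_⟩
  funext n
  rw [mem_range_encode_iff_decode_map_encode, decide_eq_true_iff]

namespace IsRecursivelyPresented

variable [Encodable (Σ i, L.Functions i)] [Encodable (Σ i, L.Relations i)]

/-- In a recursively presented language the set of codes of function symbols is computable
(Enderton §3.4). [folklore] -/
theorem computablePred_mem_range_encode_functions (hL : L.IsRecursivelyPresented) :
    ComputablePred fun n : ℕ =>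
      n ∈ Set.range (Encodable.encode : (Σ i, L.Functions i) → ℕ) :=
  computablePred_mem_range_encode hL.computable_encode_decode_functions

/-- In a recursively presented language the set of codes of relation symbols is computable
(Enderton §3.4). [folklore] -/
theorem computablePred_mem_range_encode_relations (hL : L.IsRecursivelyPresented) :
    ComputablePred fun n : ℕ =>
      n ∈ Set.range (Encodable.encode : (Σ i, L.Relations i) → ℕ) :=
  computablePred_mem_range_encode hL.computable_encode_decode_relations

/-- In a recursively presented language the set of numbers that *decode* to some function
symbol is computable (this set may be larger than the set of codes). [folklore] -/
theorem computablePred_decode_functions_isSome (hL : L.IsRecursivelyPresented) :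
    ComputablePred fun n : ℕ =>
      ((Encodable.decode (α := Σ i, L.Functions i) n).isSome : Prop) := by
  refine ComputablePred.computable_iff.2 ⟨_, Primrec.option_isSome.to_comp.comp
    hL.computable_arity_functions, ?_⟩
  ext n
  simp [Option.isSome_map]

end IsRecursivelyPresented

/-! ### Decidable, r.e. and recursively axiomatized theories -/

namespace Theory

variable [Encodable (Σ i, L.Functions i)] [Encodable (Σ i, L.Relations i)]

/-- A theory `T` is *decidable* if the set of Gödel numbers of its consequences
`{⌜φ⌝ | T ⊨ φ}` is a computable subset of `ℕ` (Enderton Ch. 3; Marker §2, Def. before 2.2.8).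
Note: this is about *consequences* (`T ⊨ᵇ φ`), not membership in the axiom set `T`;
compare `Theory.IsRecursive`. The notion is relative to the chosen coding of the symbols of `L`
(the `Encodable` instances); it is the textbook notion when `L.IsRecursivelyPresented`. [folklore] -/
def IsDecidable (T : L.Theory) : Prop :=
  ComputablePred fun n : ℕ => ∃ φ : L.Sentence, T ⊨ᵇ φ ∧ φ.godelNumber = n

/-- A theory `T` is *recursively enumerable* if the set of Gödel numbers of its consequences
`{⌜φ⌝ | T ⊨ φ}` is an r.e. subset of `ℕ` (Enderton §3.4; Marker §2). Like `Theory.IsDecidable`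
this is relative to the chosen coding of the symbols of `L`. [folklore] -/
def IsRE (T : L.Theory) : Prop :=
  REPred fun n : ℕ => ∃ φ : L.Sentence, T ⊨ᵇ φ ∧ φ.godelNumber = n

/-- A theory (set of axioms) `T` is *recursive* if membership in `T` is decidable, i.e. the set
of Gödel numbers `{⌜φ⌝ | φ ∈ T}` is computable (Enderton §3.4; Marker §2). [folklore] -/
def IsRecursive (T : L.Theory) : Prop :=
  ComputablePred fun n : ℕ => ∃ φ ∈ T, φ.godelNumber = n

/-- A theory (set of axioms) `T` is *recursively enumerable as a set of axioms* if the set of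
Gödel numbers `{⌜φ⌝ | φ ∈ T}` is r.e. (Enderton §3.4; by Craig's trick such a theory is
computably axiomatizable). [folklore] -/
def IsREAxioms (T : L.Theory) : Prop :=
  REPred fun n : ℕ => ∃ φ ∈ T, φ.godelNumber = n

/-- A theory `T` is *computably (recursively) axiomatizable* if some recursive set of sentences
`A` has exactly the same consequences as `T` (Enderton §3.4, "axiomatizable theory";
Marker §2). [folklore] -/
def IsComputablyAxiomatizable (T : L.Theory) : Prop :=
  ∃ A : L.Theory, A.IsRecursive ∧ ∀ φ : L.Sentence, A ⊨ᵇ φ ↔ T ⊨ᵇ φ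

/-- A decidable theory is recursively enumerable (a computable set is r.e.;
Mathlib `ComputablePred.to_re`). [folklore] -/
theorem IsDecidable.isRE {T : L.Theory} (h : T.IsDecidable) : T.IsRE :=
  ComputablePred.to_re h

/-- A recursive set of axioms is an r.e. set of axioms (`ComputablePred.to_re`). [folklore] -/
theorem IsRecursive.isREAxioms {T : L.Theory} (h : T.IsRecursive) : T.IsREAxioms :=
  ComputablePred.to_re h

/-- For a *maximal* theory (e.g. `L.completeTheory M`, by `completeTheory.isMaximal`),
membership and consequence coincide (`Theory.IsMaximal.mem_iff_models`), so decidability of the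
theory is the same as recursiveness of the set `T` (Marker §2). [folklore] -/
theorem isDecidable_iff_isRecursive_of_isMaximal {T : L.Theory} (h : T.IsMaximal) :
    T.IsDecidable ↔ T.IsRecursive := by
  have : (fun n : ℕ => ∃ φ : L.Sentence, T ⊨ᵇ φ ∧ φ.godelNumber = n) =
      fun n : ℕ => ∃ φ ∈ T, φ.godelNumber = n := by
    ext n
    simp only [h.mem_iff_models]
  unfold IsDecidable IsRecursive
  rw [this]

/-- A recursive set of axioms is computably axiomatizable (by itself). [folklore] -/
theorem IsRecursive.isComputablyAxiomatizable {T : L.Theory} (h : T.IsRecursive) :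
    T.IsComputablyAxiomatizable :=
  ⟨T, h, fun _ => Iff.rfl⟩

/-- **Enumerability theorem**: in a recursively presented language, the consequences of a
computably axiomatizable theory form an r.e. set (Enderton, Cor. 35B, via completeness of
first-order logic; Marker §2). The hypothesis `hL` is necessary: for a language with countably
many constants `c_k` coded by `encode c_k = f k` for an injective `f : ℕ → ℕ` with non-r.e. range
(and `decode` a total left inverse, so that arities *are* computable but the *code set*
`Set.range encode` is not), the statement fails already for `T = {∀ x y, x = y}`. [cite: Enderton2001, Cor. 35B] [cite: Marker2002, §2.2 (decidable theories)] -/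
def IsComputablyAxiomatizable.isRE : Prop :=
  ∀ (hL : L.IsRecursivelyPresented) {T : L.Theory} (h : T.IsComputablyAxiomatizable),
    T.IsRE

/-- **Janiczak's theorem** (Janiczak 1950; Enderton Cor. 3.5C; Marker Lemma 2.2.8): a complete,
computably axiomatizable theory in a recursively presented language is decidable. [cite: Janiczak1950] -/
def isDecidable_of_isComplete_of_isComputablyAxiomatizable : Prop :=
  ∀ (hL : L.IsRecursivelyPresented) {T : L.Theory} (hc : T.IsComplete) (ha : T.IsComputablyAxiomatizable),
    T.IsDecidable

end Theory

end FirstOrder.Language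

/-! ### Symbol codings for the languages of (ordered) (exp-)rings -/

namespace Literature.ModelTheory.ExponentialFields

/-- Explicit finite coding of Mathlib's ring function symbols `(+, *, -, 0, 1)` by `0, …, 4`. [folklore] -/
instance instEncodableSigmaRingFunc : Encodable (Σ i, ringFunc i) where
  encode
    | ⟨_, .add⟩ => 0
    | ⟨_, .mul⟩ => 1
    | ⟨_, .neg⟩ => 2
    | ⟨_, .zero⟩ => 3
    | ⟨_, .one⟩ => 4
  decode
    | 0 => some ⟨2, .add⟩
    | 1 => some ⟨2, .mul⟩
    | 2 => some ⟨1, .neg⟩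
    | 3 => some ⟨0, .zero⟩
    | 4 => some ⟨0, .one⟩
    | _ => none
  encodek := by rintro ⟨_, f⟩; cases f <;> rfl

/-- Explicit finite coding of the exp-ring function symbols `(+, *, -, 0, 1, exp)` by `0, …, 5`. [folklore] -/
instance instEncodableSigmaExpRingFunc : Encodable (Σ i, expRingFunc i) where
  encode
    | ⟨_, .add⟩ => 0
    | ⟨_, .mul⟩ => 1
    | ⟨_, .neg⟩ => 2
    | ⟨_, .zero⟩ => 3
    | ⟨_, .one⟩ => 4
    | ⟨_, .exp⟩ => 5
  decode
    | 0 => some ⟨2, .add⟩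
    | 1 => some ⟨2, .mul⟩
    | 2 => some ⟨1, .neg⟩
    | 3 => some ⟨0, .zero⟩
    | 4 => some ⟨0, .one⟩
    | 5 => some ⟨1, .exp⟩
    | _ => none
  encodek := by rintro ⟨_, f⟩; cases f <;> rfl

/-- Explicit coding of Mathlib's order relation symbol `≤` by `0`. [folklore] -/
instance instEncodableSigmaOrderRel : Encodable (Σ i, Language.orderRel i) where
  encode _ := 0
  decode
    | 0 => some ⟨2, .le⟩
    | _ => none
  encodek := by rintro ⟨_, r⟩; cases r; rfl

/-- The (empty) type of symbols of a language component with no symbols is encodable. This is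
already inferred by Mathlib (`Sigma.encodable` and the `Empty` instance), so it is recorded as a
non-instance `abbrev` only, used to transport the instance across the definitional unfolding of
`Language.ring.Relations` etc. [folklore] -/
abbrev instEncodableSigmaEmpty : Encodable (Σ i, (fun _ => Empty : ℕ → Type) i) :=
  inferInstanceAs (Encodable (Σ _ : ℕ, Empty))

/-- The arity function of the coding of `ringFunc` is the table `[2, 2, 1, 0, 0]`. [folklore] -/
theorem arity_ringFunc_eq :
    (fun n : ℕ => (Encodable.decode (α := Σ i, ringFunc i) n).map Sigma.fst) =
      fun n => [2, 2, 1, 0, 0][n]? := by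
  funext n
  match n with
  | 0 | 1 | 2 | 3 | 4 | _ + 5 => rfl

/-- The arity function of the coding of `expRingFunc` is the table `[2, 2, 1, 0, 0, 1]`. [folklore] -/
theorem arity_expRingFunc_eq :
    (fun n : ℕ => (Encodable.decode (α := Σ i, expRingFunc i) n).map Sigma.fst) =
      fun n => [2, 2, 1, 0, 0, 1][n]? := by
  funext n
  match n with
  | 0 | 1 | 2 | 3 | 4 | 5 | _ + 6 => rfl

/-- The arity function of the coding of `Language.orderRel` is the table `[2]`. [folklore] -/
theorem arity_orderRel_eq :
    (fun n : ℕ => (Encodable.decode (α := Σ i, Language.orderRel i) n).map Sigma.fst) =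
      fun n => [2][n]? := by
  funext n
  match n with
  | 0 | _ + 1 => rfl

/-- The arity function of the (empty) coding of an empty symbol family is constantly `none`. [folklore] -/
theorem arity_sigmaEmpty_eq :
    (fun n : ℕ => (Encodable.decode (α := Σ i, (fun _ => Empty : ℕ → Type) i) n).map Sigma.fst) =
      fun _ => none := by
  funext n
  cases Encodable.decode (α := Σ i, (fun _ => Empty : ℕ → Type) i) n with
  | none => rfl
  | some x => exact x.2.elim

/-- The arity of ring function symbols is computable from the code (a finite table;
Mathlib `Primrec.list_getElem?₁`). [folklore] -/
theorem computable_arity_ringFunc :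
    Computable fun n : ℕ => (Encodable.decode (α := Σ i, ringFunc i) n).map Sigma.fst :=
  arity_ringFunc_eq ▸ (Primrec.list_getElem?₁ _).to_comp

/-- The arity of exp-ring function symbols is computable from the code (a finite table). [folklore] -/
theorem computable_arity_expRingFunc :
    Computable fun n : ℕ => (Encodable.decode (α := Σ i, expRingFunc i) n).map Sigma.fst :=
  arity_expRingFunc_eq ▸ (Primrec.list_getElem?₁ _).to_comp

/-- The arity of the order relation symbol is computable from the code (a finite table). [folklore] -/
theorem computable_arity_orderRel :
    Computable fun n : ℕ =>
      (Encodable.decode (α := Σ i, Language.orderRel i) n).map Sigma.fst :=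
  arity_orderRel_eq ▸ (Primrec.list_getElem?₁ _).to_comp

/-- The arity function of an empty symbol family is computable (constantly `none`). [folklore] -/
theorem computable_arity_sigmaEmpty :
    Computable fun n : ℕ =>
      (Encodable.decode (α := Σ i, (fun _ => Empty : ℕ → Type) i) n).map Sigma.fst :=
  arity_sigmaEmpty_eq ▸ Computable.const _

/-- The re-encoding function of the coding of `ringFunc` is the table `[0, 1, 2, 3, 4]`. [folklore] -/
theorem encode_decode_ringFunc_eq :
    (fun n : ℕ => (Encodable.decode (α := Σ i, ringFunc i) n).map Encodable.encode) =
      fun n => [0, 1, 2, 3, 4][n]? := by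
  funext n
  match n with
  | 0 | 1 | 2 | 3 | 4 | _ + 5 => rfl

/-- The re-encoding function of the coding of `expRingFunc` is the table `[0, 1, 2, 3, 4, 5]`. [folklore] -/
theorem encode_decode_expRingFunc_eq :
    (fun n : ℕ => (Encodable.decode (α := Σ i, expRingFunc i) n).map Encodable.encode) =
      fun n => [0, 1, 2, 3, 4, 5][n]? := by
  funext n
  match n with
  | 0 | 1 | 2 | 3 | 4 | 5 | _ + 6 => rfl

/-- The re-encoding function of the coding of `Language.orderRel` is the table `[0]`. [folklore] -/
theorem encode_decode_orderRel_eq :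
    (fun n : ℕ => (Encodable.decode (α := Σ i, Language.orderRel i) n).map Encodable.encode) =
      fun n => [0][n]? := by
  funext n
  match n with
  | 0 | _ + 1 => rfl

/-- The re-encoding function of the (empty) coding of an empty symbol family is constantly
`none`. [folklore] -/
theorem encode_decode_sigmaEmpty_eq :
    (fun n : ℕ =>
      (Encodable.decode (α := Σ i, (fun _ => Empty : ℕ → Type) i) n).map Encodable.encode) =
      fun _ => none := by
  funext n
  cases Encodable.decode (α := Σ i, (fun _ => Empty : ℕ → Type) i) n with
  | none => rfl
  | some x => exact x.2.elim

/-- Re-encoding of ring function symbols is computable (a finite table). [folklore] -/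
theorem computable_encode_decode_ringFunc :
    Computable fun n : ℕ =>
      (Encodable.decode (α := Σ i, ringFunc i) n).map Encodable.encode :=
  encode_decode_ringFunc_eq ▸ (Primrec.list_getElem?₁ _).to_comp

/-- Re-encoding of exp-ring function symbols is computable (a finite table). [folklore] -/
theorem computable_encode_decode_expRingFunc :
    Computable fun n : ℕ =>
      (Encodable.decode (α := Σ i, expRingFunc i) n).map Encodable.encode :=
  encode_decode_expRingFunc_eq ▸ (Primrec.list_getElem?₁ _).to_comp

/-- Re-encoding of the order relation symbol is computable (a finite table). [folklore] -/
theorem computable_encode_decode_orderRel :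
    Computable fun n : ℕ =>
      (Encodable.decode (α := Σ i, Language.orderRel i) n).map Encodable.encode :=
  encode_decode_orderRel_eq ▸ (Primrec.list_getElem?₁ _).to_comp

/-- Re-encoding of an empty symbol family is computable (constantly `none`). [folklore] -/
theorem computable_encode_decode_sigmaEmpty :
    Computable fun n : ℕ =>
      (Encodable.decode (α := Σ i, (fun _ => Empty : ℕ → Type) i) n).map Encodable.encode :=
  encode_decode_sigmaEmpty_eq ▸ Computable.const _

/-- Function symbols of `Language.ring` are encodable (they are `FirstOrder.ringFunc`). [folklore] -/
instance Language.ring.instEncodableFunctions : Encodable (Σ i, Language.ring.Functions i) :=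
  instEncodableSigmaRingFunc

/-- Relation symbols of `Language.ring` are encodable (there are none). [folklore] -/
instance Language.ring.instEncodableRelations : Encodable (Σ i, Language.ring.Relations i) :=
  instEncodableSigmaEmpty

/-- Function symbols of `Language.orderedRing` are encodable (they are `FirstOrder.ringFunc`). [folklore] -/
instance Language.orderedRing.instEncodableFunctions :
    Encodable (Σ i, Language.orderedRing.Functions i) :=
  instEncodableSigmaRingFunc

/-- Relation symbols of `Language.orderedRing` are encodable (they are `Language.orderRel`). [folklore] -/
instance Language.orderedRing.instEncodableRelations :
    Encodable (Σ i, Language.orderedRing.Relations i) :=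
  instEncodableSigmaOrderRel

/-- Function symbols of `Language.expRing` are encodable (they are `Literature.ModelTheory.ExponentialFields.expRingFunc`). [folklore] -/
instance Language.expRing.instEncodableFunctions :
    Encodable (Σ i, Language.expRing.Functions i) :=
  instEncodableSigmaExpRingFunc

/-- Relation symbols of `Language.expRing` are encodable (there are none). [folklore] -/
instance Language.expRing.instEncodableRelations :
    Encodable (Σ i, Language.expRing.Relations i) :=
  instEncodableSigmaEmpty

/-- Function symbols of `Language.orderedExpRing` are encodable (they are `Literature.ModelTheory.ExponentialFields.expRingFunc`). [folklore] -/
instance Language.orderedExpRing.instEncodableFunctions :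
    Encodable (Σ i, Language.orderedExpRing.Functions i) :=
  instEncodableSigmaExpRingFunc

/-- Relation symbols of `Language.orderedExpRing` are encodable (they are `Language.orderRel`). [folklore] -/
instance Language.orderedExpRing.instEncodableRelations :
    Encodable (Σ i, Language.orderedExpRing.Relations i) :=
  instEncodableSigmaOrderRel

/-- `Language.ring` with the finite coding above is recursively presented. [folklore] -/
theorem Language.ring.isRecursivelyPresented : Language.ring.IsRecursivelyPresented :=
  ⟨computable_arity_ringFunc, computable_arity_sigmaEmpty, computable_encode_decode_ringFunc,
    computable_encode_decode_sigmaEmpty⟩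

/-- `Language.orderedRing` with the finite coding above is recursively presented. [folklore] -/
theorem Language.orderedRing.isRecursivelyPresented :
    Language.orderedRing.IsRecursivelyPresented :=
  ⟨computable_arity_ringFunc, computable_arity_orderRel, computable_encode_decode_ringFunc,
    computable_encode_decode_orderRel⟩

/-- `Language.expRing` with the finite coding above is recursively presented. [folklore] -/
theorem Language.expRing.isRecursivelyPresented : Language.expRing.IsRecursivelyPresented :=
  ⟨computable_arity_expRingFunc, computable_arity_sigmaEmpty,
    computable_encode_decode_expRingFunc, computable_encode_decode_sigmaEmpty⟩

/-- `Language.orderedExpRing` with the finite coding above is recursively presented. [folklore] -/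
theorem Language.orderedExpRing.isRecursivelyPresented :
    Language.orderedExpRing.IsRecursivelyPresented :=
  ⟨computable_arity_expRingFunc, computable_arity_orderRel,
    computable_encode_decode_expRingFunc, computable_encode_decode_orderRel⟩

example : Encodable Language.ring.Sentence := inferInstance
example : Encodable Language.orderedRing.Sentence := inferInstance
example : Encodable Language.expRing.Sentence := inferInstance
example : Encodable Language.orderedExpRing.Sentence := inferInstance
example : Encodable (Language.orderedExpRing.Formula ℕ) := inferInstance

/-- Sanity check that the codings are computable: the Gödel number of a concrete sentence is a
closed natural number term accepted by the compiler (no `noncomputable` marker needed). -/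
example : ℕ := (⊥ : Language.orderedExpRing.Sentence).godelNumber

end Literature.ModelTheory.ExponentialFields
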